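import Summits.AtomisticToContinuum.FouriersLaw.Theorems.OddSectorIrreversibilityResponseDensityLinearResponse
import Summits.AtomisticToContinuum.FouriersLaw.Theorems.BondHeatUncertaintySubdiffusiveBondHeatKernelGibbsE

/-!
# The `L²` response density of the pinned chain, from detailed balance

Helper file for item stmt-AtomisticToContinuum-9144 (`ResponseDensity`, route
`OddSectorIrreversibility`, sub-problem `FouriersLaw` of `AtomisticToContinuum`).

The linear-response functional of `…ResponseDensityLinearResponse.lean`,
`D(φ) = (γ/2T²) Z⁻¹ ∫₀^∞ ∫ P_s φ · e^{-H/T} g dx ds` (`g = p_0² - p_{N-1}²`, `P_s` the equilibrium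
kernels), is represented by an explicit `L²(μ_T)` density IF the equilibrium kernels satisfy the
generalised detailed balance `∫ e^{-H/T} G · P_t F dx = ∫ e^{-H/T} (F∘Θ) · P_t(G∘Θ) dx`,
`Θ(q,p) = (q,-p)` (hypothesis `hDUAL`, an explicit binder): then `D(φ) = ∫ φ h dμ_T` with
`h(x) = (γ/2T²) ∫₀^∞ P_s g (Θx) ds`, `|h| ≤ const · e^{ϑH}`, hence `h ∈ L²(μ_T)` for `2ϑ < 1/T`
(`pinnedChain_exists_responseDensity_of_dual`). Inputs: exponential convergence to the Gibbs measure
(`SubdiffusiveBondHeat.pinnedChain_exp_convergence_gibbs`) and the vanishing of the odd Gibbs moment.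
No definitions.
-/

noncomputable section

open MeasureTheory ProbabilityTheory Filter Topology Set
open scoped NNReal ENNReal ContDiff

namespace Summit.AtomisticToContinuum.FouriersLaw.Theorems

open Literature.MathematicalPhysics.KineticTheory.HeatConduction
open Literature.Probability.Process Literature.MathematicalPhysics.KineticTheory OscillatorChain

variable {N : ℕ}

section Density

variable {ω₂ lam β γ : ℝ} (hω : 0 < ω₂) (hl : 0 ≤ lam) (hβ : 0 < β) (hγ : 0 < γ)
  (hN : 0 < N) {T : ℝ} (hT : 0 < T) {ϑ : ℝ} (hϑ : 0 < ϑ) (h2ϑ : 2 * ϑ < 1 / T)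
include hω hl hβ hγ hN hT hϑ h2ϑ

omit hγ hT h2ϑ in
/-- `|p_0² - p_{N-1}²| ≤ (4/ϑ) e^{ϑH}`. -/
theorem abs_oddMoment_le_exp (x : PhaseSpace N) :
    |x.2 ⟨0, hN⟩ ^ 2 - x.2 ⟨N - 1, by omega⟩ ^ 2| ≤
      4 / ϑ * Real.exp (ϑ * (pinnedChain ω₂ lam β γ).hamiltonian N x) := by
  have h1 := SubdiffusiveBondHeat.abs_sq_momentum_sub_le_exp (γ := γ) (T := 0) hω hl hβ.le hϑ le_rfl x
    ⟨0, hN⟩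
  have h2 := SubdiffusiveBondHeat.abs_sq_momentum_sub_le_exp (γ := γ) (T := 0) hω hl hβ.le hϑ le_rfl x
    ⟨N - 1, by omega⟩
  rw [sub_zero, add_zero] at h1 h2
  calc |x.2 ⟨0, hN⟩ ^ 2 - x.2 ⟨N - 1, by omega⟩ ^ 2|
      ≤ |x.2 ⟨0, hN⟩ ^ 2| + |x.2 ⟨N - 1, by omega⟩ ^ 2| := abs_sub _ _
    _ ≤ 2 / ϑ * Real.exp (ϑ * (pinnedChain ω₂ lam β γ).hamiltonian N x) +
        2 / ϑ * Real.exp (ϑ * (pinnedChain ω₂ lam β γ).hamiltonian N x) := add_le_add h1 h2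
    _ = _ := by ring

/-- The equilibrium forecast of the odd moment decays exponentially:
`|P_s g(z)| ≤ (4/ϑ) C e^{ϑH(z)} e^{-cs}` (`μ_T(g) = 0`). -/
theorem exists_oddMoment_forecast_decay :
    ∃ C c : ℝ, 0 < C ∧ 0 < c ∧ ∀ (z : PhaseSpace N) (s : ℝ≥0),
      |∫ y, (y.2 ⟨0, hN⟩ ^ 2 - y.2 ⟨N - 1, by omega⟩ ^ 2)
          ∂((pinnedChain ω₂ lam β γ).transitionKernel N T T s z)| ≤
        C * Real.exp (ϑ * (pinnedChain ω₂ lam β γ).hamiltonian N z) * Real.exp (-c * s) := by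
  have hϑ1 : ϑ < 1 / T := by linarith
  obtain ⟨Cm, c, hCm, hc, hmix⟩ :=
    SubdiffusiveBondHeat.pinnedChain_exp_convergence_gibbs hω hl hβ hγ hN hT hϑ hϑ1
  -- `μ_T(g) = 0`
  have hδ' : ∃ δ' : ℝ, δ' ≠ 0 ∧ 0 < T + δ' / 2 ∧ 0 < T - δ' / 2 ∧
      ϑ < 1 / max (T + δ' / 2) (T - δ' / 2) := by
    refine ⟨T, hT.ne', by linarith, by linarith, ?_⟩
    rw [show max (T + T / 2) (T - T / 2) = T + T / 2 from max_eq_left (by linarith)]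
    rw [lt_div_iff₀ (by linarith)]
    rw [lt_div_iff₀ hT] at h2ϑ
    linarith
  obtain ⟨δ', hδ'0, hTL', hTR', hϑ''⟩ := hδ'
  have hG₀ := integral_gibbsWeight_oddMoment_eq_zero hω hl hβ.le hγ hN hT hTL' hTR' hϑ hϑ'' (N := N) hδ'0
  have hπg : ∫ y, (y.2 ⟨0, hN⟩ ^ 2 - y.2 ⟨N - 1, by omega⟩ ^ 2)
      ∂((pinnedChain ω₂ lam β γ).gibbsMeasure N T) = 0 := by
    rw [(pinnedChain ω₂ lam β γ).integral_gibbsMeasure]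
    simp only [OscillatorChain.gibbsDensity]
    have : ∀ x : PhaseSpace N, (x.2 ⟨0, hN⟩ ^ 2 - x.2 ⟨N - 1, by omega⟩ ^ 2) *
        Real.exp (-(pinnedChain ω₂ lam β γ).hamiltonian N x / T) =
        Real.exp (-1 / T * (pinnedChain ω₂ lam β γ).hamiltonian N x) *
          (x.2 ⟨0, hN⟩ ^ 2 - x.2 ⟨N - 1, by omega⟩ ^ 2) := fun x => by
      rw [mul_comm]; congr 1; congr 1; ring
    simp_rw [this, hG₀, mul_zero]
  refine ⟨4 / ϑ * Cm, c, by positivity, hc, fun z s => ?_⟩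
  have hg : ∀ y : PhaseSpace N, |(y.2 ⟨0, hN⟩ ^ 2 - y.2 ⟨N - 1, by omega⟩ ^ 2) / (4 / ϑ)| ≤
      Real.exp (ϑ * (pinnedChain ω₂ lam β γ).hamiltonian N y) := fun y => by
    rw [abs_div, abs_of_pos (by positivity : (0:ℝ) < 4 / ϑ), div_le_iff₀ (by positivity)]
    rw [mul_comm]; exact abs_oddMoment_le_exp hω hl hβ hN hϑ y
  have h := hmix z s (fun y => (y.2 ⟨0, hN⟩ ^ 2 - y.2 ⟨N - 1, by omega⟩ ^ 2) / (4 / ϑ))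
    (by fun_prop) hg
  rw [integral_div, integral_div, hπg, zero_div, sub_zero, abs_div,
    abs_of_pos (by positivity : (0:ℝ) < 4 / ϑ), div_le_iff₀ (by positivity)] at h
  calc _ ≤ Cm * Real.exp (ϑ * (pinnedChain ω₂ lam β γ).hamiltonian N z) * Real.exp (-c * s) * (4 / ϑ) := h
    _ = _ := by ring


/-- **The `L²(μ_T)` response density from detailed balance.** Assume the generalised detailed balance
of the equilibrium kernels against the Gibbs weight,
`∫ e^{-H/T} G · P_t F dx = ∫ e^{-H/T} (F∘Θ) · P_t(G∘Θ) dx` for `C²` functions `F, G` dominated by `e^{ϑH}`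
(`hDUAL`). Then there is `h` with `MemLp h 2 μ_T` such that for every `φ ∈ C²` with `|φ| ≤ C e^{ϑH}`:
`(γ/2T²) Z⁻¹ ∫₀^∞ ∫ P_s φ · e^{-H/T}(p_0² - p_{N-1}²) dx ds = ∫ φ h dμ_T`
(`h(x) = (γ/2T²) ∫₀^∞ P_s(p_0² - p_{N-1}²)(Θx) ds`, `|h| ≤ const · e^{ϑH}`). -/
theorem pinnedChain_exists_responseDensity_of_dual
    (hDUAL : ∀ (t : ℝ≥0) (F G : PhaseSpace N → ℝ) (CF CG : ℝ), ContDiff ℝ 2 F → ContDiff ℝ 2 G →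
      (∀ y, |F y| ≤ CF * Real.exp (ϑ * (pinnedChain ω₂ lam β γ).hamiltonian N y)) →
      (∀ y, |G y| ≤ CG * Real.exp (ϑ * (pinnedChain ω₂ lam β γ).hamiltonian N y)) →
      ∫ x, Real.exp (-1 / T * (pinnedChain ω₂ lam β γ).hamiltonian N x) * G x *
          (∫ y, F y ∂((pinnedChain ω₂ lam β γ).transitionKernel N T T t x)) =
        ∫ x, Real.exp (-1 / T * (pinnedChain ω₂ lam β γ).hamiltonian N x) * F (x.1, -x.2) *
          (∫ y, G (y.1, -y.2) ∂((pinnedChain ω₂ lam β γ).transitionKernel N T T t x))) :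
    ∃ h : PhaseSpace N → ℝ, MemLp h 2 ((pinnedChain ω₂ lam β γ).gibbsMeasure N T) ∧
      (∃ B : ℝ, ∀ x, |h x| ≤ B * Real.exp (ϑ * (pinnedChain ω₂ lam β γ).hamiltonian N x)) ∧
      ∀ (φ : PhaseSpace N → ℝ) (C : ℝ), ContDiff ℝ 2 φ →
        (∀ y, |φ y| ≤ C * Real.exp (ϑ * (pinnedChain ω₂ lam β γ).hamiltonian N y)) →
        (γ / (2 * T ^ 2)) / (∫ x, Real.exp (-1 / T * (pinnedChain ω₂ lam β γ).hamiltonian N x)) *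
            ∫ s in Ioi (0 : ℝ), ∫ x, (∫ y, φ y ∂((pinnedChain ω₂ lam β γ).transitionKernel N T T
                s.toNNReal x)) *
              (Real.exp (-1 / T * (pinnedChain ω₂ lam β γ).hamiltonian N x) *
                (x.2 ⟨0, hN⟩ ^ 2 - x.2 ⟨N - 1, by omega⟩ ^ 2)) =
          ∫ x, φ x * h x ∂((pinnedChain ω₂ lam β γ).gibbsMeasure N T) := by
  have hHc : Continuous ((pinnedChain ω₂ lam β γ).hamiltonian N) := (pinnedChain_contDiff_hamiltonian ω₂ lam β γ N (n := 0)).continuous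
  have hϑ1 : ϑ < 1 / T := by linarith
  have hθ2ϑ : -1 / T + 2 * ϑ < 0 := by
    have : -1 / T + 2 * ϑ = 2 * ϑ - 1 / T := by ring
    rw [this]; linarith
  have hgc : Continuous fun y : PhaseSpace N => y.2 ⟨0, hN⟩ ^ 2 - y.2 ⟨N - 1, by omega⟩ ^ 2 := by
    fun_prop
  obtain ⟨Cg, c, hCg, hc, hdec⟩ := exists_oddMoment_forecast_decay hω hl hβ hγ hN hT hϑ h2ϑ
  -- the inner forecast `(s, z) ↦ P_s g(z)` and its measurability
  have hmeasK := pinnedChain_measurable_integral_kernel_uncurry hω hl hβ.le hγ.le N T T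
    hgc.stronglyMeasurable (φ := fun y : PhaseSpace N => y.2 ⟨0, hN⟩ ^ 2 - y.2 ⟨N - 1, by omega⟩ ^ 2)
  have hΘm : Measurable fun x : PhaseSpace N => ((x.1, -x.2) : PhaseSpace N) :=
    measurable_fst.prodMk measurable_snd.neg
  -- the density
  obtain ⟨Ic, hIc⟩ : ∃ Ic : ℝ, Ic = ∫ s in Ioi (0 : ℝ), Real.exp (-c * s) := ⟨_, rfl⟩
  have hIc0 : 0 ≤ Ic := by rw [hIc]; exact integral_nonneg fun s => (Real.exp_pos _).le
  obtain ⟨h, hh⟩ : ∃ h : PhaseSpace N → ℝ, h = fun x => (γ / (2 * T ^ 2)) *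
    ∫ s in Ioi (0 : ℝ), ∫ y, (y.2 ⟨0, hN⟩ ^ 2 - y.2 ⟨N - 1, by omega⟩ ^ 2)
      ∂((pinnedChain ω₂ lam β γ).transitionKernel N T T s.toNNReal (x.1, -x.2)) := ⟨_, rfl⟩
  -- measurability of `h`
  have hmap : Measurable fun p : PhaseSpace N × ℝ =>
      ((p.2.toNNReal, ((p.1.1, -p.1.2) : PhaseSpace N)) : ℝ≥0 × PhaseSpace N) :=
    (measurable_real_toNNReal.comp measurable_snd).prodMk (hΘm.comp measurable_fst)
  have hFm : Measurable fun p : PhaseSpace N × ℝ => ∫ y, (y.2 ⟨0, hN⟩ ^ 2 - y.2 ⟨N - 1, by omega⟩ ^ 2)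
      ∂((pinnedChain ω₂ lam β γ).transitionKernel N T T p.2.toNNReal (p.1.1, -p.1.2)) :=
    (hmeasK.comp hmap :)
  have hhm : Measurable h := by
    rw [hh]
    exact ((hFm.stronglyMeasurable.integral_prod_right' (ν := volume.restrict (Ioi (0:ℝ)))).measurable).const_mul _
  -- the bound `|h x| ≤ B e^{ϑH(x)}`
  obtain ⟨B, hB⟩ : ∃ B : ℝ, B = (γ / (2 * T ^ 2)) * (Cg * Ic) := ⟨_, rfl⟩
  have hbound : ∀ x, |h x| ≤ B * Real.exp (ϑ * (pinnedChain ω₂ lam β γ).hamiltonian N x) := by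
    intro x
    have hHΘ : (pinnedChain ω₂ lam β γ).hamiltonian N (x.1, -x.2) = (pinnedChain ω₂ lam β γ).hamiltonian N x := (pinnedChain ω₂ lam β γ).hamiltonian_neg_momentum N x
    have h1 : ‖∫ s in Ioi (0 : ℝ), ∫ y, (y.2 ⟨0, hN⟩ ^ 2 - y.2 ⟨N - 1, by omega⟩ ^ 2)
        ∂((pinnedChain ω₂ lam β γ).transitionKernel N T T s.toNNReal (x.1, -x.2))‖ ≤
        ∫ s in Ioi (0 : ℝ), Cg * Real.exp (ϑ * (pinnedChain ω₂ lam β γ).hamiltonian N x) * Real.exp (-c * s) := by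
      refine norm_integral_le_of_norm_le (((exp_neg_integrableOn_Ioi 0 hc).const_mul _)) ?_
      rw [ae_restrict_iff' measurableSet_Ioi]
      refine Eventually.of_forall fun s hs => ?_
      rw [Real.norm_eq_abs]
      have := hdec (x.1, -x.2) s.toNNReal
      rwa [hHΘ, Real.coe_toNNReal _ (le_of_lt hs)] at this
    rw [integral_const_mul, Real.norm_eq_abs, ← hIc] at h1
    have hhx : h x = (γ / (2 * T ^ 2)) *
        ∫ s in Ioi (0 : ℝ), ∫ y, (y.2 ⟨0, hN⟩ ^ 2 - y.2 ⟨N - 1, by omega⟩ ^ 2)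
          ∂((pinnedChain ω₂ lam β γ).transitionKernel N T T s.toNNReal (x.1, -x.2)) := by rw [hh]
    rw [hhx, abs_mul, abs_of_pos (by positivity : (0:ℝ) < γ / (2 * T ^ 2)), hB]
    calc _ ≤ (γ / (2 * T ^ 2)) * (Cg * Real.exp (ϑ * (pinnedChain ω₂ lam β γ).hamiltonian N x) * Ic) :=
          mul_le_mul_of_nonneg_left h1 (by positivity)
      _ = _ := by ring
  -- `h ∈ L²(μ_T)`
  have hπ2 := pinnedChain_integrable_exp_mul_hamiltonian_gibbsMeasure hω hl hβ.le γ N hT h2ϑ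
  have hL2 : MemLp h 2 ((pinnedChain ω₂ lam β γ).gibbsMeasure N T) := by
    refine (memLp_two_iff_integrable_sq hhm.aestronglyMeasurable).2 ?_
    refine (hπ2.const_mul (B ^ 2)).mono' (hhm.pow_const 2).aestronglyMeasurable
      (Eventually.of_forall fun x => ?_)
    calc ‖h x ^ 2‖ = |h x| ^ 2 := by rw [Real.norm_eq_abs, abs_pow]
      _ ≤ (B * Real.exp (ϑ * (pinnedChain ω₂ lam β γ).hamiltonian N x)) ^ 2 :=
          pow_le_pow_left₀ (abs_nonneg _) (hbound x) 2
      _ = B ^ 2 * Real.exp (2 * ϑ * (pinnedChain ω₂ lam β γ).hamiltonian N x) := by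
          rw [mul_pow, sq (Real.exp _), ← Real.exp_add]
          congr 1; ring
  refine ⟨h, hL2, ⟨B, hbound⟩, fun φ C hφ2 hφ => ?_⟩
  have hφc : Continuous φ := hφ2.continuous
  have hC : 0 ≤ C := by
    have := (abs_nonneg _).trans (hφ 0)
    exact nonneg_of_mul_nonneg_left this (Real.exp_pos _)
  have hg4 : ∀ y : PhaseSpace N, |y.2 ⟨0, hN⟩ ^ 2 - y.2 ⟨N - 1, by omega⟩ ^ 2| ≤
      4 / ϑ * Real.exp (ϑ * (pinnedChain ω₂ lam β γ).hamiltonian N y) := abs_oddMoment_le_exp hω hl hβ hN hϑ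
  -- Step 1: detailed balance and the momentum reversal, at each time `s`
  have hstep1 : ∀ s : ℝ, ∫ x, (∫ y, φ y ∂((pinnedChain ω₂ lam β γ).transitionKernel N T T s.toNNReal x)) *
      (Real.exp (-1 / T * (pinnedChain ω₂ lam β γ).hamiltonian N x) * (x.2 ⟨0, hN⟩ ^ 2 - x.2 ⟨N - 1, by omega⟩ ^ 2)) =
      ∫ x, Real.exp (-1 / T * (pinnedChain ω₂ lam β γ).hamiltonian N x) * φ x *
        ∫ y, (y.2 ⟨0, hN⟩ ^ 2 - y.2 ⟨N - 1, by omega⟩ ^ 2)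
          ∂((pinnedChain ω₂ lam β γ).transitionKernel N T T s.toNNReal (x.1, -x.2)) := by
    intro s
    have hg2 : ContDiff ℝ 2 fun y : PhaseSpace N => y.2 ⟨0, hN⟩ ^ 2 - y.2 ⟨N - 1, by omega⟩ ^ 2 := by
      fun_prop
    have hd := hDUAL s.toNNReal φ (fun y => y.2 ⟨0, hN⟩ ^ 2 - y.2 ⟨N - 1, by omega⟩ ^ 2) C (4 / ϑ) hφ2
      hg2 hφ hg4
    simp only [Pi.neg_apply, neg_sq] at hd
    calc _ = ∫ x, Real.exp (-1 / T * (pinnedChain ω₂ lam β γ).hamiltonian N x) * (x.2 ⟨0, hN⟩ ^ 2 - x.2 ⟨N - 1, by omega⟩ ^ 2) *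
          ∫ y, φ y ∂((pinnedChain ω₂ lam β γ).transitionKernel N T T s.toNNReal x) :=
          integral_congr_ae (Eventually.of_forall fun x => by simp only; ring)
      _ = ∫ x, Real.exp (-1 / T * (pinnedChain ω₂ lam β γ).hamiltonian N x) * φ (x.1, -x.2) *
          ∫ y, (y.2 ⟨0, hN⟩ ^ 2 - y.2 ⟨N - 1, by omega⟩ ^ 2) ∂((pinnedChain ω₂ lam β γ).transitionKernel N T T s.toNNReal x) := hd
      _ = _ := by
          rw [← integral_comp_momentumReversal N (fun x => Real.exp (-1 / T * (pinnedChain ω₂ lam β γ).hamiltonian N x) *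
            φ (x.1, -x.2) * ∫ y, (y.2 ⟨0, hN⟩ ^ 2 - y.2 ⟨N - 1, by omega⟩ ^ 2)
              ∂((pinnedChain ω₂ lam β γ).transitionKernel N T T s.toNNReal x))]
          refine integral_congr_ae (Eventually.of_forall fun x => ?_)
          simp only [neg_neg, Prod.mk.eta, (pinnedChain ω₂ lam β γ).hamiltonian_neg_momentum N x]
  simp_rw [hstep1]
  -- Step 2: Fubini
  have hI2 := integrable_exp_mul_hamiltonian hω hl hβ.le γ (N := N) hθ2ϑ
  have hprod : Integrable (Function.uncurry fun (s : ℝ) (x : PhaseSpace N) =>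
      Real.exp (-1 / T * (pinnedChain ω₂ lam β γ).hamiltonian N x) * φ x *
        ∫ y, (y.2 ⟨0, hN⟩ ^ 2 - y.2 ⟨N - 1, by omega⟩ ^ 2)
          ∂((pinnedChain ω₂ lam β γ).transitionKernel N T T s.toNNReal (x.1, -x.2)))
      ((volume.restrict (Ioi (0:ℝ))).prod volume) := by
    have hm : Measurable (Function.uncurry fun (s : ℝ) (x : PhaseSpace N) =>
        Real.exp (-1 / T * (pinnedChain ω₂ lam β γ).hamiltonian N x) * φ x *
          ∫ y, (y.2 ⟨0, hN⟩ ^ 2 - y.2 ⟨N - 1, by omega⟩ ^ 2)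
            ∂((pinnedChain ω₂ lam β γ).transitionKernel N T T s.toNNReal (x.1, -x.2))) :=
      ((((Real.continuous_exp.comp (continuous_const.mul hHc)).mul hφc).measurable.comp measurable_snd).mul
        (hFm.comp measurable_swap) :)
    refine (((exp_neg_integrableOn_Ioi 0 hc).const_mul (C * Cg)).mul_prod hI2).mono' hm.aestronglyMeasurable
      (Eventually.of_forall fun p => ?_)
    rcases p with ⟨s, x⟩
    have hHΘ : (pinnedChain ω₂ lam β γ).hamiltonian N (x.1, -x.2) = (pinnedChain ω₂ lam β γ).hamiltonian N x := (pinnedChain ω₂ lam β γ).hamiltonian_neg_momentum N x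
    have hK := hdec (x.1, -x.2) s.toNNReal
    rw [hHΘ] at hK
    have hs : Real.exp (-c * (s.toNNReal : ℝ)) ≤ Real.exp (-c * s) :=
      Real.exp_le_exp.2 (by nlinarith [Real.le_coe_toNNReal s, hc])
    simp only [Function.uncurry_apply_pair]
    rw [Real.norm_eq_abs, abs_mul, abs_mul, abs_of_pos (Real.exp_pos _),
      show (-1 / T + 2 * ϑ) * (pinnedChain ω₂ lam β γ).hamiltonian N x =
        -1 / T * (pinnedChain ω₂ lam β γ).hamiltonian N x + ϑ * (pinnedChain ω₂ lam β γ).hamiltonian N x + ϑ * (pinnedChain ω₂ lam β γ).hamiltonian N x by ring,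
      Real.exp_add, Real.exp_add]
    have hE1 := (Real.exp_pos (-1 / T * (pinnedChain ω₂ lam β γ).hamiltonian N x)).le
    have hE2 := (Real.exp_pos (ϑ * (pinnedChain ω₂ lam β γ).hamiltonian N x)).le
    calc Real.exp (-1 / T * (pinnedChain ω₂ lam β γ).hamiltonian N x) * |φ x| *
          |∫ y, (y.2 ⟨0, hN⟩ ^ 2 - y.2 ⟨N - 1, by omega⟩ ^ 2) ∂((pinnedChain ω₂ lam β γ).transitionKernel N T T s.toNNReal (x.1, -x.2))|
        ≤ Real.exp (-1 / T * (pinnedChain ω₂ lam β γ).hamiltonian N x) * (C * Real.exp (ϑ * (pinnedChain ω₂ lam β γ).hamiltonian N x)) *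
          (Cg * Real.exp (ϑ * (pinnedChain ω₂ lam β γ).hamiltonian N x) * Real.exp (-c * s)) := by
          refine mul_le_mul (mul_le_mul_of_nonneg_left (hφ x) hE1) (hK.trans ?_) (abs_nonneg _)
            (by positivity)
          exact mul_le_mul_of_nonneg_left hs (by positivity)
      _ = _ := by ring
  rw [integral_integral_swap hprod]
  -- Step 3: the inner time integral is `h / (γ/2T²)`; then the Gibbs normalisation
  simp_rw [integral_const_mul]
  rw [(pinnedChain ω₂ lam β γ).integral_gibbsMeasure]
  have hρ : ∀ x : PhaseSpace N, (pinnedChain ω₂ lam β γ).gibbsDensity N T x = Real.exp (-1 / T * (pinnedChain ω₂ lam β γ).hamiltonian N x) := fun x => by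
    simp only [OscillatorChain.gibbsDensity]; congr 1; ring
  simp_rw [hρ]
  rw [div_eq_mul_inv, mul_comm (γ / (2 * T ^ 2)), mul_assoc, ← integral_const_mul]
  congr 1
  refine integral_congr_ae (Eventually.of_forall fun x => ?_)
  have hhx : h x = (γ / (2 * T ^ 2)) *
      ∫ s in Ioi (0 : ℝ), ∫ y, (y.2 ⟨0, hN⟩ ^ 2 - y.2 ⟨N - 1, by omega⟩ ^ 2)
        ∂((pinnedChain ω₂ lam β γ).transitionKernel N T T s.toNNReal (x.1, -x.2)) := by rw [hh]
  simp only [hhx]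
  ring

end Density

end Summit.AtomisticToContinuum.FouriersLaw.Theorems

end
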